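import Summits.NavierStokesRegularity.NavierStokesRegularity.Theses.AxisymmetricExtremality
import Summits.NavierStokesRegularity.NavierStokesRegularity.Theorems.AxisymmetricSwirlRegularity
import Literature.Analysis.FluidPDE.RusinSverakCompactness
import Literature.Analysis.FluidPDE.AxisymmetricEuler
import Literature.Analysis.FluidPDE.SelfSimilar
import Summits.NavierStokesRegularity.NavierStokesRegularity.Theorems.AxisymmetricExtremalityAxisymmetricKatoGlobalNoSwirlStratum

/-!
# Strategist s14 (family `s`, independent census) — typed objects of the STRATEGY CENSUS for the crux
# `AxisymmetricKatoGlobal` (item stmt-NavierStokesRegularity-15453) of route AxisymmetricExtremality.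

Nothing here is a route item or a stub; every `def` is a candidate replacement / piece / strengthening
examined in `STRATEGY-CENSUS-s14.md`, and every `theorem` is the (pure-logic) seam showing how the
candidate would sit relative to the crux and to the summit. No `sorry`.

* §W  weaker intermediates read off the summit statement and `closes`:
      `NoAxisymMinimalDatum` (the threshold instance `closes` actually consumes),
      `AxisymThresholdClosed` (its closedness reformulation);
* §D  decompositions: D-A `AKGClayClass ∧ TailBridge`, D-D `ZoomNonConstant ∧ KNSSLiouvilleAxisym`;
* §T  the solved sibling in the crux's own class: `NoSwirlKatoGlobal`;
* §S  the quantitative strengthening `QuantAKG`;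
* §N  the negation, normal form `not_AKG_iff`.
-/

namespace Summit.NavierStokesRegularity.NavierStokesRegularity.Cruxes.AxisymmetricKatoGlobal.StrategistS14

open MeasureTheory Set Function
open Literature.Analysis Literature.Analysis.FluidPDE
open Summit.NavierStokesRegularity.NavierStokesRegularity.Theses.AxisymmetricExtremality
open scoped ENNReal NNReal ContDiff

local notation "ℝ³" => EuclideanSpace ℝ (Fin 3)
local notation "ℂ³" => EuclideanSpace ℂ (Fin 3)

/-- The datum class of the crux, bundled: `u₀ ∈ L³`, represented by `g ∈ Ḣ^{1/2}`, weakly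
divergence-free, axisymmetric about the `x₂`-axis (`IsAxisymmetric`, which is the crux's written-out
equivariance clause by `Iff.rfl`). -/
def IsCritAxisymDatum (u₀ : ℝ³ → ℝ³) (g : FunctionSpaces.HomSobolev ℝ³ ℂ³ (1 / 2 : ℝ)) : Prop :=
  MemLp u₀ 3 volume ∧ g.Represents (FunctionSpaces.EuclideanSpace.complexify ∘ u₀) ∧
    IsWeaklyDivFree u₀ ∧ IsAxisymmetric u₀

/-- The crux in bundled form (definitional unfolding of `IsAxisymmetric` / `rotZ`). -/
theorem AKG_iff : AxisymmetricKatoGlobal ↔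
    ∀ ν : ℝ, 0 < ν → ∀ (u₀ : ℝ³ → ℝ³) (g : FunctionSpaces.HomSobolev ℝ³ ℂ³ (1 / 2 : ℝ)),
      IsCritAxisymDatum u₀ g → HasGlobalKatoSolution ν u₀ := by
  constructor
  · rintro h ν hν u₀ g ⟨h1, h2, h3, h4⟩
    exact h ν hν u₀ g h1 h2 h3 h4
  · intro h ν hν u₀ g h1 h2 h3 h4
    exact h ν hν u₀ g ⟨h1, h2, h3, h4⟩

/-! ## §W — weaker intermediates read off the summit statement -/

/-- **W1 (threshold instance).** No Rusin–Šverák `Ḣ^{1/2}`-minimal blow-up datum is axisymmetric.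
This is *exactly* the instance of the crux that the route's deciding theorem `closes` consumes. -/
def NoAxisymMinimalDatum : Prop :=
  ∀ ν : ℝ, 0 < ν → ∀ (u₀ : ℝ³ → ℝ³) (g : FunctionSpaces.HomSobolev ℝ³ ℂ³ (1 / 2 : ℝ)),
    IsMinimalBlowupDatum ν u₀ g → IsAxisymmetric u₀ → False

/-- The crux implies W1 (trivial direction: W1 is weaker). -/
theorem noAxisymMinimalDatum_of_AKG (h : AxisymmetricKatoGlobal) : NoAxisymMinimalDatum := by
  intro ν hν u₀ g hmin hax
  obtain ⟨hL3, hrep, hdiv, -, hnot⟩ := hmin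
  exact hnot (h ν hν u₀ g hL3 hrep hdiv hax)

/-- W1 can replace the crux in the route: the deciding theorem re-proved with W1 in place of
`AxisymmetricKatoGlobal` (same pure logic as `closes`). -/
theorem closes_of_noAxisymMinimalDatum (h₂ : MinimalDatumPFold) (h₄ : PFoldToAxisymmetric)
    (hW : NoAxisymMinimalDatum) : _root_.NavierStokesRegularity := by
  show Literature.NS.NavierStokesExistenceSmoothR3
  intro ν hν u₀ hsm hdiv hdec
  by_contra hno
  obtain ⟨u₁, g, hmin, hax⟩ := h₄ ν hν (h₂ ν hν ⟨u₀, hsm, hdiv, hdec, hno⟩)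
  exact hW ν hν u₁ g hmin hax

/-- Conversely, given the route's other two cruxes, the summit gives W1 back only through
`¬ (Clay fails)`; W1 itself is NOT implied by the summit (Clay (A) does not force
`ρ_max^pure = ∞`), so W1 is logically incomparable with `NavierStokesRegularity` and sits strictly
below the crux. What W1 adds to the bare blow-up question is the single hypothesis
`‖g‖ₑ = ρ_max^pure(ν)`, i.e. every datum of smaller norm — in particular `(1-ε) u₀` — is global.
The only way to consume that hypothesis is a closedness principle at `u₀`: -/
def AxisymThresholdClosed : Prop :=
  ∀ ν : ℝ, 0 < ν → ∀ (u₀ : ℝ³ → ℝ³) (g : FunctionSpaces.HomSobolev ℝ³ ℂ³ (1 / 2 : ℝ)),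
    IsCritAxisymDatum u₀ g →
      (∀ ε : ℝ, 0 < ε → ε < 1 → HasGlobalKatoSolution ν ((1 - ε) • u₀)) → HasGlobalKatoSolution ν u₀

/-! ## §D — decompositions -/

/-- **D-A piece 1.** AX for Clay-class axisymmetric data (smooth, divergence-free, rapidly
decaying — hence finite energy and bounded swirl `Γ = r u_θ`), in Kato form: the conjecture leaf
`AxisymmetricSwirlRegularity` (ns.S25, Ladyzhenskaya 1968) up to the solution class. -/
def AKGClayClass : Prop :=
  ∀ ν : ℝ, 0 < ν → ∀ (u₀ : ℝ³ → ℝ³) (g : FunctionSpaces.HomSobolev ℝ³ ℂ³ (1 / 2 : ℝ)),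
    ContDiff ℝ ∞ u₀ → NSWave0.IsDivFree u₀ → HasRapidSpatialDecay u₀ →
      g.Represents (FunctionSpaces.EuclideanSpace.complexify ∘ u₀) → IsAxisymmetric u₀ →
        HasGlobalKatoSolution ν u₀

/-- **D-A piece 2.** The tail / closedness bridge from the Clay class to the critical class
(`L³ ∩ Ḣ^{1/2}`, infinite energy and unbounded `Γ` at spatial infinity allowed). -/
def TailBridge : Prop :=
  AKGClayClass → AxisymmetricKatoGlobal

/-- D-A assembles by modus ponens (a legitimate bridge split: piece 1 is open and substantive). -/
theorem AKG_of_DA (h₁ : AKGClayClass) (h₂ : TailBridge) : AxisymmetricKatoGlobal :=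
  h₂ h₁

/-- Piece 1 is implied by the crux, given the route's PROVED support item `ClayDatumCritical`. -/
theorem AKGClayClass_of_AKG (hC : ClayDatumCritical) (h : AxisymmetricKatoGlobal) : AKGClayClass := by
  intro ν hν u₀ g hsm hdiv hdec hrep hax
  obtain ⟨hL3, hwdiv, -⟩ := hC u₀ hsm hdiv hdec
  exact h ν hν u₀ g hL3 hrep hwdiv hax

/-- **D-D piece 2 (KNSS Liouville conjecture, axisymmetric case).** A bounded ancient mild solution
with axisymmetric slices is spatially constant (slice-wise a.e.; the constant may depend on `t`). -/
def KNSSLiouvilleAxisym : Prop :=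
  ∀ ν : ℝ, 0 < ν → ∀ u : ℝ → ℝ³ → ℝ³, IsBoundedAncientMildSolution ν u →
    (∀ t < 0, IsAxisymmetric (u t)) → ∃ b : ℝ → ℝ³, ∀ t < 0, u t =ᵐ[volume] fun _ => b t

/-- **D-D piece 1 (non-degenerate zoom).** Every axisymmetric critical datum WITHOUT a global Kato
solution generates — by some rescaling about its (axial) singularity — a bounded ancient mild
solution with axisymmetric slices which is NOT slice-wise constant. Known when the blow-up is
Type I (KNSS 2009 §6 / Seregin–Šverák 2009); open for Type II, where the velocity-normalised zoom
may degenerate to a constant axial drift `c • e₃`. -/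
def ZoomNonConstant : Prop :=
  ∀ ν : ℝ, 0 < ν → ∀ (u₀ : ℝ³ → ℝ³) (g : FunctionSpaces.HomSobolev ℝ³ ℂ³ (1 / 2 : ℝ)),
    IsCritAxisymDatum u₀ g → ¬ HasGlobalKatoSolution ν u₀ →
      ∃ v : ℝ → ℝ³ → ℝ³, IsBoundedAncientMildSolution ν v ∧ (∀ t < 0, IsAxisymmetric (v t)) ∧
        ¬ ∃ b : ℝ → ℝ³, ∀ t < 0, v t =ᵐ[volume] fun _ => b t

/-- D-D assembles by pure logic (all analysis is inside the pieces). -/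
theorem AKG_of_DD (h₁ : ZoomNonConstant) (h₂ : KNSSLiouvilleAxisym) : AxisymmetricKatoGlobal := by
  rw [AKG_iff]
  intro ν hν u₀ g hd
  by_contra hno
  obtain ⟨v, hv, hvax, hnc⟩ := h₁ ν hν u₀ g hd hno
  exact hnc (h₂ ν hν v hv hvax)

/-- … and piece 1 is implied by the crux VACUOUSLY (no blow-up, nothing to zoom into) — the tell
that D-D relocates, rather than splits, the Type II difficulty. -/
theorem zoomNonConstant_of_AKG (h : AxisymmetricKatoGlobal) : ZoomNonConstant := by
  rw [AKG_iff] at h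
  intro ν hν u₀ g hd hno
  exact absurd (h ν hν u₀ g hd) hno

/-! ## §T — the solved sibling, stated in the crux's own class -/

/-- **T1.** The no-swirl sibling in the critical Kato class. In the Clay class this is the PROVED
tree theorem `Literature.Analysis.FluidPDE.axisymmetric_no_swirl_global_regularity_holds`
(Ladyzhenskaya / Ukhovskii–Yudovich 1968). -/
def NoSwirlKatoGlobal : Prop :=
  ∀ ν : ℝ, 0 < ν → ∀ (u₀ : ℝ³ → ℝ³) (g : FunctionSpaces.HomSobolev ℝ³ ℂ³ (1 / 2 : ℝ)),
    IsCritAxisymDatum u₀ g → HasNoSwirl u₀ → HasGlobalKatoSolution ν u₀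

theorem noSwirlKatoGlobal_of_AKG (h : AxisymmetricKatoGlobal) : NoSwirlKatoGlobal := by
  rw [AKG_iff] at h
  exact fun ν hν u₀ g hd _ => h ν hν u₀ g hd

/-- … and in the crux's own critical Kato class it is now a LANDED THEOREM (2026-08-27,
`…Theorems.AxisymmetricKatoGlobal.NoSwirlStratum.axisymmetricKatoGlobal_noSwirl_stratum`): the
swirl-free stratum of the crux holds for every `ν > 0` (the `Ḣ^{1/2}` representative is not even
needed). Consequence used in the postscript: the `O(2)`-fixed locus of the minimal-datum set is
EMPTY unconditionally, so "mirror upstream" route variants carry the whole summit in their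
topological step. -/
theorem noSwirlKatoGlobal_holds : NoSwirlKatoGlobal :=
  fun _ν hν _u₀ _g hd hsw =>
    Summit.NavierStokesRegularity.NavierStokesRegularity.Theorems.AxisymmetricKatoGlobal.NoSwirlStratum.hasGlobalKatoSolution_of_isAxisymmetric_hasNoSwirl_viscosity
      hν hd.1 hd.2.2.1 hd.2.2.2 hsw

/-- Hence no minimal blow-up datum is axisymmetric AND swirl-free (W1 holds on the no-swirl
stratum; all of W1's content is in the swirl). -/
theorem noAxisymMinimalDatum_noSwirl :
    ∀ ν : ℝ, 0 < ν → ∀ (u₀ : ℝ³ → ℝ³) (g : FunctionSpaces.HomSobolev ℝ³ ℂ³ (1 / 2 : ℝ)),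
      IsMinimalBlowupDatum ν u₀ g → IsAxisymmetric u₀ → HasNoSwirl u₀ → False := by
  intro ν hν u₀ g hmin hax hsw
  exact hmin.2.2.2.2 (noSwirlKatoGlobal_holds ν hν u₀ g ⟨hmin.1, hmin.2.1, hmin.2.2.1, hax⟩ hsw)

/-! ## §S — strengthening -/

/-- **S⁺ (quantitative AX).** Global Kato solutions with an `L³` bound uniform on bounded sets of
axisymmetric data — the form an induction-on-norm / critical-element proof would deliver. -/
def QuantAKG : Prop :=
  ∀ ν : ℝ, 0 < ν → ∀ ρ : ℝ≥0∞, ∃ B : ℝ≥0∞, (ρ < ⊤ → B < ⊤) ∧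
    ∀ (u₀ : ℝ³ → ℝ³) (g : FunctionSpaces.HomSobolev ℝ³ ℂ³ (1 / 2 : ℝ)),
      IsCritAxisymDatum u₀ g → ‖g‖ₑ ≤ ρ →
        ∃ u : ℝ → ℝ³ → ℝ³, IsGlobalMildSolution ν 0 u₀ u ∧ ContinuousInLpOn (Ici 0) 3 u ∧ u 0 = u₀ ∧
          AEStronglyMeasurable (uncurry u) (volume.restrict (Ioi 0 ×ˢ univ)) ∧
            ∀ t, 0 ≤ t → eLpNorm (u t) 3 volume ≤ B

theorem AKG_of_quantAKG (h : QuantAKG) : AxisymmetricKatoGlobal := by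
  rw [AKG_iff]
  intro ν hν u₀ g hd
  obtain ⟨B, -, hB⟩ := h ν hν ‖g‖ₑ
  obtain ⟨u, hu, hc, h0, hm, -⟩ := hB u₀ g hd le_rfl
  exact ⟨u, hu, hc, h0, hm⟩

/-! ## §N — negation -/

/-- Normal form of the negation: a counterexample is one viscosity and one axisymmetric critical
datum without a global Kato solution (by `knss_no_axisymmetric_typeI_holds` and
`Seregin2020_axisymmetricSingularPoint_typeII` its singularity would have to be Type II, on the
axis, not self-similar). -/
theorem not_AKG_iff : ¬ AxisymmetricKatoGlobal ↔
    ∃ ν : ℝ, 0 < ν ∧ ∃ (u₀ : ℝ³ → ℝ³) (g : FunctionSpaces.HomSobolev ℝ³ ℂ³ (1 / 2 : ℝ)),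
      IsCritAxisymDatum u₀ g ∧ ¬ HasGlobalKatoSolution ν u₀ := by
  rw [AKG_iff]
  push Not
  rfl

end Summit.NavierStokesRegularity.NavierStokesRegularity.Cruxes.AxisymmetricKatoGlobal.StrategistS14
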